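import Mathlib
import HarnessLib
import Literature.Algebra.EuclideanLattices.LatticePoissonSummation
import Literature.Analysis.Fourier.TorusCharactersIndependent
import Summits.AtomisticToContinuum.Crystallization.Theorems.HolmgrenBoyleLindPatchHull

/-!
# Route `HolmgrenBoyleLind`: Lennard-Jones force fields of separated sources, part 11 —
lattice-invariant sources: fundamental-domain representatives, height counting, structure factors

Support file for the crux item stmt-AtomisticToContinuum-6075 (`HalfSpaceUniqueContinuation`, line
`registered`, layered core; infrastructure written by a stub-worker of lead c3). Setting: a unit
normal `u ∈ ℝ³`, the plane `W = (ℝ ∙ u)ᗮ` with orthogonal projection `P`, a full lattice `Λ ≤ W`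
(`IsZLattice`), and a set `D ⊆ ℝ³` invariant under translation by `Λ`. Instead of the orbit
quotient we use CANONICAL REPRESENTATIVES: the points of `D` whose projection lies in the
fundamental parallelepiped `fdom Λ` of `Literature.Algebra.EuclideanLattices.LatticePeriodic`.

* `hbl_exists_repsEquiv` — `(q, ℓ) ↦ q + ℓ` is a bijection `{reps} × Λ ≃ D` (every orbit meets the
  strip over `fdom Λ` exactly once, `ZSpan.fract` / `ZSpan.fract_eq_fract`);
* `hbl_reps_height_finite`, `hbl_exists_reps_height_count` — for a `δ`-separated `D` lying in the
  closed half-space `{⟪y, u⟫ ≥ a}`: finitely many representatives below any height, and at most `N`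
  of them in any height window of length `1` (packing in a bounded slab over `fdom Λ`,
  `card_le_of_separated_of_dist_le`);
* `hbl_summable_reps_exp_neg_height` — hence `∑_q e^{-λ (⟪q,u⟫ - a)} ≤ N e^{λ} / (1 - e^{-λ}) < ∞`
  for `λ > 0`;
* **`hbl_reps_layer_empty_of_structureFactors`** — for two disjoint `Λ`-invariant sets `D₊, D₋`
  with `D₊ ∪ D₋` separated: if at height `η` every STRUCTURE FACTOR vanishes,
  `∑_{q ∈ reps D₊, ⟪q,u⟫ = η} e_{-k}(P q) − ∑_{q ∈ reps D₋, ⟪q,u⟫ = η} e_{-k}(P q) = 0` for all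
  integer frequencies `k`, then neither set has a point at height `η` (distinct representatives are
  distinct points of the torus `W/Λ`; independence of torus characters,
  `Literature.Analysis.Fourier.eq_zero_of_forall_sum_mul_cexp_eq_zero`).
All `[folklore]`; nothing here closes an item.
-/

noncomputable section

namespace Summit.AtomisticToContinuum.Crystallization.Theorems.HolmgrenBoyleLind

open scoped BigOperators Topology InnerProductSpace RealInnerProductSpace
open MeasureTheory Filter Set Literature.Algebra.EuclideanLattices.LatticePeriodic

local notation "E3" => EuclideanSpace ℝ (Fin 3)

/-! ## Geometry of the plane `(ℝ ∙ u)ᗮ` and its lattice -/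

section Helpers

variable {u : E3}

/-- `z = P z + ⟪z, u⟫ u` for a unit vector `u`. [folklore] -/
private theorem lo_decomp (hu : ‖u‖ = 1) (z : E3) :
    (((ℝ ∙ u)ᗮ.orthogonalProjectionOnto z : (ℝ ∙ u)ᗮ) : E3) + ⟪z, u⟫ • u = z := by
  rw [Submodule.orthogonalProjectionOnto_orthogonal, Submodule.coe_mk,
    Submodule.starProjection_unit_singleton ℝ hu, real_inner_comm, sub_add_cancel]

/-- Vectors of the plane are orthogonal to `u`. [folklore] -/
private theorem lo_inner_coe (ℓ : (ℝ ∙ u)ᗮ) : ⟪(ℓ : E3), u⟫ = 0 :=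
  Submodule.mem_orthogonal_singleton_iff_inner_left.1 ℓ.2

/-- `P (y + ℓ) = P y + ℓ` for `ℓ` in the plane. [folklore] -/
private theorem lo_proj_add_coe (y : E3) (ℓ : (ℝ ∙ u)ᗮ) :
    (ℝ ∙ u)ᗮ.orthogonalProjectionOnto (y + ℓ) = (ℝ ∙ u)ᗮ.orthogonalProjectionOnto y + ℓ := by
  rw [map_add, Submodule.orthogonalProjectionOnto_mem_subspace_eq_self]

/-- `‖z‖ ≤ ‖P z‖ + |⟪z, u⟫|`. [folklore] -/
private theorem lo_norm_le (hu : ‖u‖ = 1) (z : E3) :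
    ‖z‖ ≤ ‖(ℝ ∙ u)ᗮ.orthogonalProjectionOnto z‖ + |⟪z, u⟫| := by
  conv_lhs => rw [← lo_decomp hu z]
  refine (norm_add_le _ _).trans (le_of_eq ?_)
  rw [Submodule.coe_norm, norm_smul, hu, mul_one, Real.norm_eq_abs]

/-- Two points with the same projection and the same height coincide. [folklore] -/
private theorem lo_eq_of_proj_eq (hu : ‖u‖ = 1) {z w : E3}
    (hp : (ℝ ∙ u)ᗮ.orthogonalProjectionOnto z = (ℝ ∙ u)ᗮ.orthogonalProjectionOnto w)
    (hh : ⟪z, u⟫ = ⟪w, u⟫) : z = w := by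
  rw [← lo_decomp hu z, ← lo_decomp hu w, hp, hh]

variable (Λ : Submodule ℤ (ℝ ∙ u)ᗮ) [DiscreteTopology Λ] [IsZLattice ℝ Λ]

/-- Two points of `fdom Λ` differing by a lattice vector are equal. [folklore] -/
private theorem lo_fdom_eq {x x' : (ℝ ∙ u)ᗮ} (hx : x ∈ fdom Λ) (hx' : x' ∈ fdom Λ)
    (h : -x + x' ∈ Λ) : x = x' := by
  have ex : ZSpan.fract (rBasis Λ) x = x := ZSpan.fract_eq_self.2 hx
  have ex' : ZSpan.fract (rBasis Λ) x' = x' := ZSpan.fract_eq_self.2 hx'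
  rw [← ex, ← ex']
  exact (ZSpan.fract_eq_fract _ _ _).2 (by rwa [rBasis_span])

/-- **Canonical representative of an orbit.** For `y` in a `Λ`-invariant `D` there are `q ∈ D`
with `P q ∈ fdom Λ`, of the same height as `y`, and `ℓ ∈ Λ` with `q + ℓ = y`. [folklore] -/
private theorem lo_exists_rep {D : Set E3}
    (hD : ∀ ℓ : Λ, ∀ y : E3, y + ((ℓ : (ℝ ∙ u)ᗮ) : E3) ∈ D ↔ y ∈ D) {y : E3} (hy : y ∈ D) :
    ∃ q : E3, ∃ ℓ : Λ, (q ∈ D ∧ (ℝ ∙ u)ᗮ.orthogonalProjectionOnto q ∈ fdom Λ) ∧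
      ⟪q, u⟫ = ⟪y, u⟫ ∧ q + ((ℓ : (ℝ ∙ u)ᗮ) : E3) = y := by
  set v : Submodule.span ℤ (Set.range (rBasis Λ)) :=
    ZSpan.floor (rBasis Λ) ((ℝ ∙ u)ᗮ.orthogonalProjectionOnto y)
  set ℓ : Λ := ⟨(v : (ℝ ∙ u)ᗮ), (rBasis_span Λ).le v.2⟩
  refine ⟨y + (((-ℓ : Λ) : (ℝ ∙ u)ᗮ) : E3), ℓ, ⟨(hD (-ℓ) y).2 hy, ?_⟩, ?_, ?_⟩
  · rw [lo_proj_add_coe]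
    have : (ℝ ∙ u)ᗮ.orthogonalProjectionOnto y + ((-ℓ : Λ) : (ℝ ∙ u)ᗮ) =
        ZSpan.fract (rBasis Λ) ((ℝ ∙ u)ᗮ.orthogonalProjectionOnto y) := by
      rw [ZSpan.fract_apply, sub_eq_add_neg]
      rfl
    rw [this]
    exact ZSpan.fract_mem_fundamentalDomain _ _
  · rw [inner_add_left, lo_inner_coe, add_zero]
  · rw [add_assoc]
    simp

end Helpers

/-! ## Canonical representatives -/

/-- **Representatives.** For a full lattice `Λ ≤ (ℝ ∙ u)ᗮ` and a `Λ`-invariant `D ⊆ ℝ³`, the map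
`(q, ℓ) ↦ q + ℓ` from `{q ∈ D | P q ∈ fdom Λ} × Λ` to `D` is a bijection. [folklore] -/
theorem hbl_exists_repsEquiv {u : E3} (Λ : Submodule ℤ (ℝ ∙ u)ᗮ) [DiscreteTopology Λ]
    [IsZLattice ℝ Λ] {D : Set E3}
    (hD : ∀ ℓ : Λ, ∀ y : E3, y + ((ℓ : (ℝ ∙ u)ᗮ) : E3) ∈ D ↔ y ∈ D) :
    ∃ e : {q : E3 // q ∈ D ∧ (ℝ ∙ u)ᗮ.orthogonalProjectionOnto q ∈ fdom Λ} × Λ ≃ D,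
      ∀ q ℓ, ((e (q, ℓ) : D) : E3) = (q : E3) + ((ℓ : (ℝ ∙ u)ᗮ) : E3) := by
  set f : {q : E3 // q ∈ D ∧ (ℝ ∙ u)ᗮ.orthogonalProjectionOnto q ∈ fdom Λ} × Λ → D :=
    fun p => ⟨(p.1 : E3) + ((p.2 : (ℝ ∙ u)ᗮ) : E3), (hD p.2 p.1).2 p.1.2.1⟩
  have hinj : Function.Injective f := by
    rintro ⟨q, ℓ⟩ ⟨q', ℓ'⟩ h
    have h1 : (q : E3) + ((ℓ : (ℝ ∙ u)ᗮ) : E3) = q' + ((ℓ' : (ℝ ∙ u)ᗮ) : E3) :=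
      congrArg Subtype.val h
    have h2 : (ℝ ∙ u)ᗮ.orthogonalProjectionOnto q + (ℓ : (ℝ ∙ u)ᗮ) =
        (ℝ ∙ u)ᗮ.orthogonalProjectionOnto q' + (ℓ' : (ℝ ∙ u)ᗮ) := by
      rw [← lo_proj_add_coe, ← lo_proj_add_coe, h1]
    have h3 : (ℝ ∙ u)ᗮ.orthogonalProjectionOnto q = (ℝ ∙ u)ᗮ.orthogonalProjectionOnto q' := by
      refine lo_fdom_eq Λ q.2.2 q'.2.2 ?_
      have : -(ℝ ∙ u)ᗮ.orthogonalProjectionOnto (q : E3) + (ℝ ∙ u)ᗮ.orthogonalProjectionOnto q' =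
          (ℓ : (ℝ ∙ u)ᗮ) - ℓ' := by
        rw [eq_sub_of_add_eq h2.symm]
        abel
      rw [this]
      exact Λ.sub_mem ℓ.2 ℓ'.2
    have h4 : (ℓ : (ℝ ∙ u)ᗮ) = ℓ' := by rwa [h3, add_right_inj] at h2
    have h5 : (q : E3) = q' := by
      rw [h4] at h1
      exact add_right_cancel h1
    exact Prod.ext (Subtype.ext h5) (Subtype.ext h4)
  have hsurj : Function.Surjective f := by
    rintro ⟨y, hy⟩
    obtain ⟨q, ℓ, hq, -, hqy⟩ := lo_exists_rep Λ hD hy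
    exact ⟨(⟨q, hq⟩, ℓ), Subtype.ext hqy⟩
  exact ⟨Equiv.ofBijective f ⟨hinj, hsurj⟩, fun q ℓ => rfl⟩

/-! ## Height counting for separated invariant sets -/

/-- Finitely many representatives below any height, for a `δ`-separated `Λ`-invariant set in the
closed half-space `{⟪y, u⟫ ≥ a}`. [folklore] -/
theorem hbl_reps_height_finite {u : E3} (hu : ‖u‖ = 1) (Λ : Submodule ℤ (ℝ ∙ u)ᗮ)
    [DiscreteTopology Λ] [IsZLattice ℝ Λ] {D : Set E3} {δ a : ℝ} (hδ : 0 < δ)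
    (hsep : ∀ x ∈ D, ∀ y ∈ D, x ≠ y → δ ≤ dist x y) (ha : ∀ y ∈ D, a ≤ ⟪y, u⟫) (Y : ℝ) :
    {q : E3 | (q ∈ D ∧ (ℝ ∙ u)ᗮ.orthogonalProjectionOnto q ∈ fdom Λ) ∧ ⟪q, u⟫ ≤ Y}.Finite := by
  obtain ⟨C, hC⟩ := (fdom_isBounded Λ).exists_norm_le
  refine (hbl_finite_near hδ hsep 0 (C + (|a| + |Y|))).subset ?_
  rintro q ⟨⟨hqD, hqf⟩, hqY⟩
  refine ⟨hqD, ?_⟩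
  rw [dist_zero_right]
  calc ‖q‖ ≤ ‖(ℝ ∙ u)ᗮ.orthogonalProjectionOnto q‖ + |⟪q, u⟫| := lo_norm_le hu q
    _ ≤ C + (|a| + |Y|) := by
        refine add_le_add (hC _ hqf) (abs_le.2 ⟨?_, ?_⟩)
        · linarith [ha q hqD, neg_abs_le a, abs_nonneg Y]
        · linarith [le_abs_self Y, abs_nonneg a]

/-- **Uniform height count.** At most `N = N(δ, Λ)` representatives in any height window of length
`1`. [folklore] -/
theorem hbl_exists_reps_height_count {u : E3} (hu : ‖u‖ = 1) (Λ : Submodule ℤ (ℝ ∙ u)ᗮ)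
    [DiscreteTopology Λ] [IsZLattice ℝ Λ] {δ : ℝ} (hδ : 0 < δ) :
    ∃ N : ℕ, ∀ (D : Set E3), (∀ x ∈ D, ∀ y ∈ D, x ≠ y → δ ≤ dist x y) → ∀ Y : ℝ,
      {q : E3 | (q ∈ D ∧ (ℝ ∙ u)ᗮ.orthogonalProjectionOnto q ∈ fdom Λ) ∧
        Y ≤ ⟪q, u⟫ ∧ ⟪q, u⟫ ≤ Y + 1}.encard ≤ N := by
  obtain ⟨C, hC⟩ := (fdom_isBounded Λ).exists_norm_le
  set R : ℝ := |C| + 1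
  have hR0 : 0 ≤ R := by positivity
  refine ⟨⌊(2 * R / δ + 1) ^ 3⌋₊, fun D hsep Y => ?_⟩
  set S := {q : E3 | (q ∈ D ∧ (ℝ ∙ u)ᗮ.orthogonalProjectionOnto q ∈ fdom Λ) ∧
    Y ≤ ⟪q, u⟫ ∧ ⟪q, u⟫ ≤ Y + 1}
  have hSsub : S ⊆ {q : E3 | q ∈ D ∧ dist q (Y • u) ≤ R} := by
    rintro q ⟨⟨hqD, hqf⟩, h1, h2⟩
    refine ⟨hqD, ?_⟩
    rw [dist_eq_norm]
    calc ‖q - Y • u‖ ≤ ‖(ℝ ∙ u)ᗮ.orthogonalProjectionOnto (q - Y • u)‖ + |⟪q - Y • u, u⟫| :=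
          lo_norm_le hu _
      _ = ‖(ℝ ∙ u)ᗮ.orthogonalProjectionOnto q‖ + |⟪q, u⟫ - Y| := by
          rw [map_sub, map_smul,
            Submodule.orthogonalProjectionOnto_orthogonalComplement_singleton_eq_zero, smul_zero,
            sub_zero, inner_sub_left, real_inner_smul_left, real_inner_self_eq_norm_sq, hu,
            one_pow, mul_one]
      _ ≤ |C| + 1 :=
          add_le_add ((hC _ hqf).trans (le_abs_self C)) (abs_le.2 ⟨by linarith, by linarith⟩)
  have hfin : S.Finite := (hbl_finite_near hδ hsep (Y • u) R).subset hSsub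
  rw [hfin.encard_eq_coe_toFinset_card]
  have hcard := Literature.MathematicalPhysics.StatisticalMechanics.card_le_of_separated_of_dist_le
    hfin.toFinset (Y • u) hδ hR0 (fun c hc => (hSsub (hfin.mem_toFinset.1 hc)).2)
    (fun c hc d hd hcd => hsep c (hfin.mem_toFinset.1 hc).1.1 d (hfin.mem_toFinset.1 hd).1.1 hcd)
  rw [finrank_euclideanSpace_fin] at hcard
  exact_mod_cast Nat.le_floor hcard

/-- **Summability over representatives.** For `λ > 0` the series `∑_q e^{-λ(⟪q,u⟫ - a)}` over the
representatives of a set `D ⊆ {⟪y,u⟫ ≥ a}` with at most `N` representatives in every height window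
of length `1` (the height count of a separated set, `hbl_exists_reps_height_count`) converges, with
sum at most `N e^{λ} / (1 - e^{-λ})` (window `j` contributes `≤ N e^{-λ j}`). [folklore] -/
theorem hbl_summable_reps_exp_neg_height {u : E3} (Λ : Submodule ℤ (ℝ ∙ u)ᗮ)
    [DiscreteTopology Λ] [IsZLattice ℝ Λ] {D : Set E3} {a : ℝ} (ha : ∀ y ∈ D, a ≤ ⟪y, u⟫) {N : ℕ}
    (hN : ∀ Y : ℝ, {q : E3 | (q ∈ D ∧ (ℝ ∙ u)ᗮ.orthogonalProjectionOnto q ∈ fdom Λ) ∧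
        Y ≤ ⟪q, u⟫ ∧ ⟪q, u⟫ ≤ Y + 1}.encard ≤ N) {l : ℝ} (hl : 0 < l) :
    Summable (fun q : {q : E3 // q ∈ D ∧ (ℝ ∙ u)ᗮ.orthogonalProjectionOnto q ∈ fdom Λ} =>
        Real.exp (-(l * (⟪(q : E3), u⟫ - a)))) ∧
      ∑' q : {q : E3 // q ∈ D ∧ (ℝ ∙ u)ᗮ.orthogonalProjectionOnto q ∈ fdom Λ},
          Real.exp (-(l * (⟪(q : E3), u⟫ - a))) ≤ N * Real.exp l / (1 - Real.exp (-l)) := by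
  classical
  set T := {q : E3 // q ∈ D ∧ (ℝ ∙ u)ᗮ.orthogonalProjectionOnto q ∈ fdom Λ}
  set f : T → ℝ := fun q => Real.exp (-(l * (⟪(q : E3), u⟫ - a)))
  have hf0 : 0 ≤ f := fun q => (Real.exp_pos _).le
  set r : ℝ := Real.exp (-l) with hr
  have hr0 : 0 ≤ r := (Real.exp_pos _).le
  have hr1 : r < 1 := Real.exp_lt_one_iff.2 (neg_neg_of_pos hl)
  -- every finite partial sum is bounded by the geometric series `N ∑_j r^j`
  have hbound : ∀ F : Finset T, ∑ q ∈ F, f q ≤ N / (1 - r) := by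
    intro F
    let jf : T → ℕ := fun q => ⌊⟪(q : E3), u⟫ - a⌋₊
    have hmaps : ∀ q ∈ F, jf q ∈ Finset.range (F.sup jf + 1) := fun q hq =>
      Finset.mem_range.2 (Nat.lt_succ_of_le (Finset.le_sup hq))
    rw [← Finset.sum_fiberwise_of_maps_to hmaps]
    have hfib : ∀ j ∈ Finset.range (F.sup jf + 1), ∑ q ∈ F with jf q = j, f q ≤ N * r ^ j := by
      intro j _
      have hwin : ∀ q ∈ F.filter (fun q => jf q = j), f q ≤ r ^ j := by
        intro q hq
        have hj : jf q = j := (Finset.mem_filter.1 hq).2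
        have h0 : 0 ≤ ⟪(q : E3), u⟫ - a := sub_nonneg.2 (ha _ q.2.1)
        have hle : (j : ℝ) ≤ ⟪(q : E3), u⟫ - a := hj ▸ Nat.floor_le h0
        rw [hr, ← Real.exp_nat_mul]
        exact Real.exp_le_exp.2 (by nlinarith)
      have hcardle : ((F.filter (fun q => jf q = j)).card : ℝ) ≤ N := by
        set G := F.filter (fun q => jf q = j)
        have hsub : ((G.map (Function.Embedding.subtype _) : Finset E3) : Set E3) ⊆
            {q : E3 | (q ∈ D ∧ (ℝ ∙ u)ᗮ.orthogonalProjectionOnto q ∈ fdom Λ) ∧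
              (a + j) ≤ ⟪q, u⟫ ∧ ⟪q, u⟫ ≤ (a + j) + 1} := by
          intro x hx
          rw [Finset.coe_map, Set.mem_image] at hx
          obtain ⟨q, hq, rfl⟩ := hx
          have hj : jf q = j := (Finset.mem_filter.1 (Finset.mem_coe.1 hq)).2
          have h0 : 0 ≤ ⟪(q : E3), u⟫ - a := sub_nonneg.2 (ha _ q.2.1)
          have hle : (j : ℝ) ≤ ⟪(q : E3), u⟫ - a := hj ▸ Nat.floor_le h0
          have hlt : ⟪(q : E3), u⟫ - a < j + 1 := hj ▸ Nat.lt_floor_add_one _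
          exact ⟨q.2, by simp only [Function.Embedding.coe_subtype]; linarith,
            by simp only [Function.Embedding.coe_subtype]; linarith⟩
        have h1 : ((G.map (Function.Embedding.subtype _)).card : ℕ∞) ≤ N := by
          rw [← Set.encard_coe_eq_coe_finsetCard]
          exact (Set.encard_le_encard hsub).trans (hN (a + j))
        rw [Finset.card_map] at h1
        exact_mod_cast h1
      calc ∑ q ∈ F with jf q = j, f q ≤ ∑ q ∈ F with jf q = j, r ^ j := Finset.sum_le_sum hwin
        _ = ((F.filter (fun q => jf q = j)).card : ℝ) * r ^ j := by
            rw [Finset.sum_const, nsmul_eq_mul]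
        _ ≤ N * r ^ j := mul_le_mul_of_nonneg_right hcardle (pow_nonneg hr0 _)
    calc ∑ j ∈ Finset.range (F.sup jf + 1), ∑ q ∈ F with jf q = j, f q
        ≤ ∑ j ∈ Finset.range (F.sup jf + 1), (N : ℝ) * r ^ j := Finset.sum_le_sum hfib
      _ = N * ∑ j ∈ Finset.range (F.sup jf + 1), r ^ j := by rw [Finset.mul_sum]
      _ ≤ N * (1 - r)⁻¹ := by
          refine mul_le_mul_of_nonneg_left ?_ (Nat.cast_nonneg N)
          rw [← tsum_geometric_of_lt_one hr0 hr1]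
          exact (summable_geometric_of_lt_one hr0 hr1).sum_le_tsum _ (fun j _ => pow_nonneg hr0 j)
      _ = N / (1 - r) := (div_eq_mul_inv _ _).symm
  refine ⟨summable_of_sum_le hf0 hbound, (Real.tsum_le_of_sum_le hf0 hbound).trans ?_⟩
  have h1r : 0 < 1 - r := sub_pos.2 hr1
  rw [div_le_div_iff_of_pos_right h1r]
  have hN0 : (0 : ℝ) ≤ N := Nat.cast_nonneg N
  have hexp : 1 ≤ Real.exp l := Real.one_le_exp hl.le
  nlinarith

/-! ## Structure factors -/

/-- Core of `hbl_reps_layer_empty_of_structureFactors`: two disjoint finite families of points of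
one height whose projections lie in `fdom Λ`, with equal character sums for every frequency, are
both empty (independence of the characters of `(ℝ ∙ u)ᗮ / Λ`). [folklore] -/
private theorem lo_union_eq_empty_of_sum_echar_eq {u : E3} (hu : ‖u‖ = 1)
    (Λ : Submodule ℤ (ℝ ∙ u)ᗮ) [DiscreteTopology Λ] [IsZLattice ℝ Λ] {Ap Am : Finset E3} {η : ℝ}
    (hdisj : Disjoint Ap Am)
    (hfd : ∀ q ∈ Ap ∪ Am, (ℝ ∙ u)ᗮ.orthogonalProjectionOnto q ∈ fdom Λ)
    (hη : ∀ q ∈ Ap ∪ Am, ⟪q, u⟫ = η)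
    (hSF : ∀ k : Fin (Module.finrank ℝ (ℝ ∙ u)ᗮ) → ℤ,
      ∑ q ∈ Ap, echar Λ (-k) ((ℝ ∙ u)ᗮ.orthogonalProjectionOnto q) =
        ∑ q ∈ Am, echar Λ (-k) ((ℝ ∙ u)ᗮ.orthogonalProjectionOnto q)) :
    Ap ∪ Am = ∅ := by
  classical
  set s : Finset E3 := Ap ∪ Am with hs
  set e : {q // q ∈ s} ≃ Fin s.card := s.equivFin
  set pt : Fin s.card → Fin (Module.finrank ℝ (ℝ ∙ u)ᗮ) → ℝ :=
    fun j i => (rBasis Λ).repr ((ℝ ∙ u)ᗮ.orthogonalProjectionOnto (e.symm j : E3)) i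
  set c : Fin s.card → ℂ := fun j => if ((e.symm j : {q // q ∈ s}) : E3) ∈ Ap then 1 else -1
    with hc
  -- distinct representatives of one height have projections distinct modulo `Λ`
  have hq : ∀ i j : Fin s.card, i ≠ j → ∃ l, ¬ ∃ m : ℤ, pt i l - pt j l = m := by
    intro i j hij
    by_contra hcon
    push Not at hcon
    apply hij
    have hmem : (ℝ ∙ u)ᗮ.orthogonalProjectionOnto ((e.symm i : {q // q ∈ s}) : E3) -
        (ℝ ∙ u)ᗮ.orthogonalProjectionOnto ((e.symm j : {q // q ∈ s}) : E3) ∈ Λ := by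
      refine mem_of_rBasis_repr Λ fun l => ?_
      obtain ⟨m, hm⟩ := hcon l
      exact ⟨m, by rw [map_sub, Finsupp.sub_apply]; exact hm⟩
    have hP : (ℝ ∙ u)ᗮ.orthogonalProjectionOnto ((e.symm j : {q // q ∈ s}) : E3) =
        (ℝ ∙ u)ᗮ.orthogonalProjectionOnto ((e.symm i : {q // q ∈ s}) : E3) :=
      lo_fdom_eq Λ (hfd _ (e.symm j).2) (hfd _ (e.symm i).2) (by rwa [neg_add_eq_sub])
    have hpt' : ((e.symm j : {q // q ∈ s}) : E3) = e.symm i :=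
      lo_eq_of_proj_eq hu hP (by rw [hη _ (e.symm j).2, hη _ (e.symm i).2])
    exact (e.symm.injective (Subtype.ext hpt')).symm
  -- the vanishing of the signed structure factors, in coordinates
  have hzero := Literature.Analysis.Fourier.eq_zero_of_forall_sum_mul_cexp_eq_zero pt c hq ?_
  · by_contra hne
    obtain ⟨q, hqs⟩ := Finset.nonempty_iff_ne_empty.2 hne
    have h := hzero (e ⟨q, hqs⟩)
    simp only [hc, Equiv.symm_apply_apply] at h
    split_ifs at h <;> norm_num at h
  · intro k
    have hchar : ∀ j : Fin s.card,
        Complex.exp (2 * Real.pi * Complex.I * ∑ l, ((k l : ℤ) : ℂ) * ((pt j l : ℝ) : ℂ)) =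
          echar Λ k ((ℝ ∙ u)ᗮ.orthogonalProjectionOnto ((e.symm j : {q // q ∈ s}) : E3)) := by
      intro j
      rw [echar]
      congr 1; push_cast; rfl
    have hsum : ∑ j, c j * Complex.exp (2 * Real.pi * Complex.I *
          ∑ l, ((k l : ℤ) : ℂ) * ((pt j l : ℝ) : ℂ)) =
        ∑ q ∈ s, (if q ∈ Ap then (1 : ℂ) else -1) *
          echar Λ k ((ℝ ∙ u)ᗮ.orthogonalProjectionOnto q) := by
      simp_rw [hchar]
      rw [← Finset.sum_coe_sort s]
      exact e.symm.sum_comp (fun q : {q // q ∈ s} => (if (q : E3) ∈ Ap then (1 : ℂ) else -1) *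
        echar Λ k ((ℝ ∙ u)ᗮ.orthogonalProjectionOnto (q : E3)))
    rw [hsum, hs, Finset.sum_union hdisj]
    have h1 : ∑ q ∈ Ap, (if q ∈ Ap then (1 : ℂ) else -1) *
          echar Λ k ((ℝ ∙ u)ᗮ.orthogonalProjectionOnto q) =
        ∑ q ∈ Ap, echar Λ k ((ℝ ∙ u)ᗮ.orthogonalProjectionOnto q) :=
      Finset.sum_congr rfl fun q hq => by rw [if_pos hq, one_mul]
    have h2 : ∑ q ∈ Am, (if q ∈ Ap then (1 : ℂ) else -1) *
          echar Λ k ((ℝ ∙ u)ᗮ.orthogonalProjectionOnto q) =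
        -∑ q ∈ Am, echar Λ k ((ℝ ∙ u)ᗮ.orthogonalProjectionOnto q) := by
      rw [← Finset.sum_neg_distrib]
      exact Finset.sum_congr rfl fun q hq => by
        rw [if_neg (Finset.disjoint_right.1 hdisj hq), neg_one_mul]
    rw [h1, h2, ← sub_eq_add_neg, sub_eq_zero]
    simpa using hSF (-k)

/-- **Vanishing structure factors empty a layer.** Let `D₊, D₋ ⊆ ℝ³` be disjoint, each invariant
under the full lattice `Λ ≤ (ℝ ∙ u)ᗮ` (`‖u‖ = 1`), with `D₊ ∪ D₋` `δ`-separated and contained in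
`{⟪y,u⟫ ≥ a}`. If at the height `η` all structure factors of the signed layer vanish — for every
integer frequency `k`,
`∑_{q ∈ reps D₊, ⟪q,u⟫ = η} echar Λ (-k) (P q) = ∑_{q ∈ reps D₋, ⟪q,u⟫ = η} echar Λ (-k) (P q)` —
then `D₊` and `D₋` have no point at height `η`. [folklore] -/
theorem hbl_reps_layer_empty_of_structureFactors : ∀ {u : EuclideanSpace ℝ (Fin 3)} (hu : ‖u‖ = 1)
    (Λ : Submodule ℤ (ℝ ∙ u)ᗮ) [DiscreteTopology Λ] [IsZLattice ℝ Λ]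
    {Dp Dm : Set (EuclideanSpace ℝ (Fin 3))} {δ a : ℝ} (hδ : 0 < δ), Disjoint Dp Dm →
    ∀ (hsep : ∀ x ∈ Dp ∪ Dm, ∀ y ∈ Dp ∪ Dm, x ≠ y → δ ≤ dist x y)
    (ha : ∀ y ∈ Dp ∪ Dm, a ≤ inner ℝ y u),
    (∀ ℓ : Λ, ∀ y : EuclideanSpace ℝ (Fin 3),
      y + ((ℓ : (ℝ ∙ u)ᗮ) : EuclideanSpace ℝ (Fin 3)) ∈ Dp ↔ y ∈ Dp) →
    (∀ ℓ : Λ, ∀ y : EuclideanSpace ℝ (Fin 3),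
      y + ((ℓ : (ℝ ∙ u)ᗮ) : EuclideanSpace ℝ (Fin 3)) ∈ Dm ↔ y ∈ Dm) →
    ∀ η : ℝ, (∀ k : Fin (Module.finrank ℝ (ℝ ∙ u)ᗮ) → ℤ,
      ∑ q ∈
      (Summit.AtomisticToContinuum.Crystallization.Theorems.HolmgrenBoyleLind.hbl_reps_height_finite
          hu Λ hδ (fun x hx y hy => hsep x (Or.inl hx) y (Or.inl hy)) (fun y hy => ha y (Or.inl hy))
          η).toFinset with inner ℝ q u = η,
        Literature.Algebra.EuclideanLattices.LatticePeriodic.echar Λ (-k)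
          ((ℝ ∙ u)ᗮ.orthogonalProjectionOnto q) =
      ∑ q ∈
      (Summit.AtomisticToContinuum.Crystallization.Theorems.HolmgrenBoyleLind.hbl_reps_height_finite
          hu Λ hδ (fun x hx y hy => hsep x (Or.inr hx) y (Or.inr hy)) (fun y hy => ha y (Or.inr hy))
          η).toFinset with inner ℝ q u = η,
        Literature.Algebra.EuclideanLattices.LatticePeriodic.echar Λ (-k)
          ((ℝ ∙ u)ᗮ.orthogonalProjectionOnto q)) →
    (∀ y ∈ Dp, inner ℝ y u ≠ η) ∧ (∀ y ∈ Dm, inner ℝ y u ≠ η) := by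
  intro u hu Λ _ _ Dp Dm δ a hδ hdisj hsep ha hDp hDm η hSF
  have key := lo_union_eq_empty_of_sum_echar_eq (η := η) hu Λ ?_ ?_ ?_ hSF
  · rw [Finset.union_eq_empty] at key
    refine ⟨fun y hy hyη => ?_, fun y hy hyη => ?_⟩
    · obtain ⟨q, ℓ, hq, hqy, -⟩ := lo_exists_rep Λ hDp hy
      refine Finset.notMem_empty q (key.1 ▸ Finset.mem_filter.2 ⟨?_, hqy.trans hyη⟩)
      exact (Set.Finite.mem_toFinset _).2 ⟨hq, (hqy.trans hyη).le⟩
    · obtain ⟨q, ℓ, hq, hqy, -⟩ := lo_exists_rep Λ hDm hy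
      refine Finset.notMem_empty q (key.2 ▸ Finset.mem_filter.2 ⟨?_, hqy.trans hyη⟩)
      exact (Set.Finite.mem_toFinset _).2 ⟨hq, (hqy.trans hyη).le⟩
  · refine Finset.disjoint_left.2 fun q hqp hqm => Set.disjoint_left.1 hdisj
      ((Set.Finite.mem_toFinset _).1 (Finset.mem_filter.1 hqp).1).1.1
      ((Set.Finite.mem_toFinset _).1 (Finset.mem_filter.1 hqm).1).1.1
  · intro q hq
    rcases Finset.mem_union.1 hq with h | h <;>
      exact ((Set.Finite.mem_toFinset _).1 (Finset.mem_filter.1 h).1).1.2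
  · intro q hq
    rcases Finset.mem_union.1 hq with h | h <;> exact (Finset.mem_filter.1 h).2

end Summit.AtomisticToContinuum.Crystallization.Theorems.HolmgrenBoyleLind

end
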